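import Literature.AnabelianGeometry.EtaleTheta.KummerEquivarianceAction

/-!
# Inner automorphisms from `H` act trivially on `H¹(H, Λ(A))`; the `G`-action on `lim_{→} H¹(S i, Λ(A))`
# kills `⋂ᵢ S i` (proof-only companion of `KummerEquivariance(Action).lean`; LANA §6.1 p.31)

Source: LANA Project interim report [LANA2026Report], §6.1, p. 31 ("the natural action of `G` on `H¹`").
Classical fact ([cite: NeukirchSchmidtWingberg2008, I §5]): for a normal subgroup `H ⊴ G` and `h ∈ H`,
the automorphism of `H¹(H, M)` induced by the pair (conjugation by `h`, `m ↦ h • m`) is the IDENTITY — on a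
cocycle `y` the conjugate cocycle `γ ↦ h • y(h⁻¹ γ h)` differs from `y` by the coboundary of `y(h)`.
Consequently the natural action of `G` on `H¹(H, Λ A)` factors through `G/H`, and the action of `G` on the
colimit `lim_{→ i} H¹(S i, Λ A)` over a directed system of normal subgroups (abc-iut-w4-d007's
`conjColimMulAut`, `KummerEquivarianceAction.lean`) is TRIVIAL on `⋂ᵢ S i`.  In the [IUTchII] §3
consumer ([IUTchII] Prop. 3.1 (ii) "equipped with a natural conjugation action by `Π_X(M^Θ_*)`"; Prop. 3.3
"well-defined up to composition with an inner automorphism") this is what makes the conjugation action of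
`Π_X(M^Θ_*)` on the constant monoid insensitive to the inner automorphisms coming from the open subgroups
themselves, and — for the model system of preimages `ε_k⁻¹(N)` of `MonoidKummerEquivariantModel.lean` —
makes the `Π_k`-action factor through `Π_k / ker ε_k ≅ G_k`.

PROVED (no definitions): `CoMorphism.cyclotome_map_conj`, `CoMorphism.conjAct_eq_self_of_mem`,
`CoMorphism.conjColimMap_eq_self_of_forall_mem`, `CoMorphism.conjColimMulAut_eq_one_of_forall_mem`.
Nothing here bears on [IUTchIII] Cor. 3.12.
-/

noncomputable section

namespace Literature.AnabelianGeometry.EtaleTheta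

open groupCohomology CategoryTheory

namespace CoMorphism

section Level

variable {G : Type} [Group G] {A : Type} [CommGroup A] [MulDistribMulAction G A]
  (H : Subgroup G) [H.Normal]

/-- The module map of `conj h` on the cyclotome IS the action of `h`: `Λ(h • ·) ζ = h • ζ`.
[cite: LANA2026Report, §6.1 p.31] -/
theorem cyclotome_map_conj (h : G) (ζ : cyclotome A) : cyclotome.map (conj G A h).map ζ = h • ζ :=
  Subtype.ext (funext fun _ => rfl)

/-- **Inner automorphisms from `H` act trivially on `H¹(H, Λ(A))`**: for `h ∈ H` (`H` normal in `G`),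
`conjAct H h = id` — on a cocycle `y` the conjugate cocycle `γ ↦ h • y(h⁻¹ γ h)` is `y` plus the
coboundary `γ ↦ γ • y(h) - y(h)`. [cite: NeukirchSchmidtWingberg2008, I §5] -/
theorem conjAct_eq_self_of_mem {h : G} (hh : h ∈ H) (x : H1 (cyclotomeRep (A := A) H)) :
    conjAct H h x = x := by
  induction x using H1_induction_on with
  | h y =>
    change ((conj G A h).H1Map (conj_cond h H)) (H1π _ y) = H1π _ y
    rw [H1Map, H1π_comp_map_apply, H1π_eq_iff]
    -- the coboundary of `y ⟨h, hh⟩`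
    refine ⟨y ⟨h, hh⟩, ?_⟩
    funext γ
    -- left: `(d₀₁ _) (y hH) γ = ρ γ (y hH) - y hH`; right: `h • y (h⁻¹ γ h) - y γ`
    have hconj : (conj G A h).groupHomRestrict (conj_cond h H) γ = ⟨h, hh⟩⁻¹ * γ * ⟨h, hh⟩ :=
      Subtype.ext (by
        change h⁻¹ * (γ : G) * h⁻¹⁻¹ = h⁻¹ * γ * h
        rw [inv_inv])
    have hcocycle := (mem_cocycles₁_iff (A := cyclotomeRep (A := A) H) y).1 y.2
    have e1 : y (⟨h, hh⟩⁻¹ * γ * ⟨h, hh⟩) =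
        (cyclotomeRep (A := A) H).ρ (⟨h, hh⟩⁻¹ * γ) (y ⟨h, hh⟩) + y (⟨h, hh⟩⁻¹ * γ) := hcocycle _ _
    have e2 : y (⟨h, hh⟩⁻¹ * γ) = (cyclotomeRep (A := A) H).ρ ⟨h, hh⟩⁻¹ (y γ) + y ⟨h, hh⟩⁻¹ := hcocycle _ _
    have e3 : (cyclotomeRep (A := A) H).ρ ⟨h, hh⟩ (y ⟨h, hh⟩⁻¹) = -y ⟨h, hh⟩ := cocycles₁_map_inv y _
    -- the module map of `conj h` is `ρ ⟨h, hh⟩`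
    have emap : ∀ v : cyclotomeRep (A := A) H,
        ((conj G A h).cyclotomeHom (conj_cond h H)).hom v = (cyclotomeRep (A := A) H).ρ ⟨h, hh⟩ v := by
      intro v
      rw [cyclotomeHom_hom_apply, cyclotome_map_conj]
      rfl
    simp only [Pi.sub_apply]
    change (cyclotomeRep (A := A) H).ρ γ (y ⟨h, hh⟩) - y ⟨h, hh⟩ =
      ((conj G A h).cyclotomeHom (conj_cond h H)).hom
          (y ((conj G A h).groupHomRestrict (conj_cond h H) γ)) - y γ
    rw [emap, hconj, e1, e2, map_add, map_add, ← Module.End.mul_apply, ← map_mul, ← Module.End.mul_apply,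
      ← map_mul, mul_inv_cancel_left, e3, mul_inv_cancel, map_one, Module.End.one_apply]
    abel

end Level

section Colim

variable {G : Type} [Group G] {A : Type} [CommGroup A] [MulDistribMulAction G A]
  {ι : Type} [Preorder ι] [DecidableEq ι] [IsDirectedOrder ι] [Nonempty ι] (S : ι → Subgroup G)
  (hS : ∀ ⦃i j : ι⦄, i ≤ j → S j ≤ S i) [hN : ∀ i, (S i).Normal]

/-- **An element of `⋂ᵢ S i` acts trivially on `lim_{→ i} H¹(S i, Λ A)`** (every class comes from some
level `i`, where the element is an inner automorphism from `S i`). [cite: LANA2026Report, §6.1 p.31] -/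
theorem conjColimMap_eq_self_of_forall_mem {g : G} (hg : ∀ i, g ∈ S i) (z : H1Colimit A S hS) :
    conjColimMap S hS g z = z := by
  induction z using AddCommGroup.DirectLimit.induction_on with
  | ih i x => rw [conjColimMap_toColimit, conjAct_eq_self_of_mem (A := A) (S i) (hg i)]

/-- The same for the packaged action `conjColimMulAut : G →* MulAut (Multiplicative (lim_{→} H¹))`: the
normal subgroup `⋂ᵢ S i` lies in its KERNEL, i.e. the action factors through `G / ⋂ᵢ S i`.
[cite: LANA2026Report, §6.1 p.31] -/
theorem conjColimMulAut_eq_one_of_forall_mem {g : G} (hg : ∀ i, g ∈ S i) :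
    conjColimMulAut (A := A) S hS g = 1 :=
  MulEquiv.ext fun z => by
    rw [conjColimMulAut_apply, conjColimMap_eq_self_of_forall_mem S hS hg]
    rfl

end Colim

end CoMorphism

end Literature.AnabelianGeometry.EtaleTheta

end
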